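import Summits.CriticalPhenomena.CardyFormulaZ2.Theorems.CardySusyWardDiscretisationFamilyExistsCutCycle
import HarnessLib

/-!
# The boundary walk from one cut edge reaches the other — helper for `DiscretisationFamilyExists` (stmt-CriticalPhenomena-9644)

The left-hand boundary walk `bwalk` of `DiscreteFaceBoundary.lean` (on the face-boundary darts of
discrete Dobrushin data, inner face on the left) is periodic and dart-simple within a period; the
tree proves this under `IsZdAdmissible`, only for its finiteness.  Here the same facts are
recorded for BOUNDED data with positive mesh (no arcs needed), together with the consequence used
in the construction of admissible data:

* `exists_bwalk_period'`, `bwalk_injOn_of_minimal` — a period exists; within the least period the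
  darts are distinct;
* `W_bloop_eq_one_of_reach` — for a regular domain, the closed walk of one least period has
  winding number one on every inner face joined to the left face of the start dart by side steps
  through inner faces (left faces have winding number one, and the walk never separates two
  inner faces);
* `exists_bwalk_eq_of_reach` — hence every face-boundary dart whose left face is so joined LIES ON
  THE WALK;
* `reachable_deleteEdges_of_bwalk` — following the walk from the head of that dart back to the
  start gives, in the graph of `Ω_δ`-edges between boundary sites with the two edges deleted, a
  connection from the head of the second dart to the tail of the first (the input `hwb` of
  `reachable_deleteEdges_colouring`).
-/

noncomputable section

namespace Summit.CriticalPhenomena.CardyFormulaZ2.Theorems.DiscretisationFamilyExists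

open Set Relation SimpleGraph Literature.Probability.LatticeModels Literature.Topology.PlaneTopology
  Literature.Probability.LatticeModels.DiscreteDobrushin

variable {E : DiscreteDobrushin} {d₀ : Site 2 × Fin 4}

/-! ### Periods of the boundary walk for bounded data -/

/-- Face-boundary darts of bounded data with positive mesh are finitely many. [folklore] -/
theorem finite_isOutEdge' (hΩ : Bornology.IsBounded E.Ω) (hδ : 0 < E.δ) :
    {p : Site 2 × Fin 4 | E.IsOutEdge p.1 p.2}.Finite := by
  have hF := finite_hasAllSides (D := E) hΩ hδ
  have hfin : {p : Site 2 × Fin 4 | E.IsInnerFace (cFace p)}.Finite := by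
    have : {p : Site 2 × Fin 4 | E.IsInnerFace (cFace p)} =
        (fun p : Site 2 × Fin 4 => (cFace p, p.2)) ⁻¹'
          ({F | HasAllSides (discreteDomainGraph E.Ω E.δ) F} ×ˢ (Set.univ : Set (Fin 4))) := by
      ext p; simp [isInnerFace_iff_hasAllSides]
    rw [this]
    refine Set.Finite.preimage (fun p _ q _ h => ?_) (hF.prod (Set.toFinite _))
    simp only [Prod.mk.injEq, cFace, faceAt] at h
    obtain ⟨h1, h2⟩ := h
    rw [h2] at h1
    exact Prod.ext (sub_left_injective h1) h2
  exact hfin.subset fun _ hp => hp.1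

/-- **The boundary walk is periodic** (bounded data, positive mesh). [folklore] -/
theorem exists_bwalk_period' (hΩ : Bornology.IsBounded E.Ω) (hδ : 0 < E.δ) (h₀ : E.IsOutEdge d₀.1 d₀.2) :
    ∃ P, 0 < P ∧ E.bwalk d₀ P = d₀ := by
  obtain ⟨i, j, hij, h⟩ := (finite_isOutEdge' hΩ hδ).exists_lt_map_eq_of_forall_mem
    (f := E.bwalk d₀) (isOutEdge_bwalk h₀)
  refine ⟨j - i, by omega, ?_⟩
  have := bwalk_eq_of_add_eq h₀ (i := 0) (j := j - i) i
    (by rwa [zero_add, Nat.sub_add_cancel hij.le])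
  exact this.symm

/-- Within a minimal period the darts of the walk are distinct. [folklore] -/
theorem bwalk_injOn_of_minimal (h₀ : E.IsOutEdge d₀.1 d₀.2) {P : ℕ}
    (hmin : ∀ m, 0 < m → m < P → E.bwalk d₀ m ≠ d₀) {s t : ℕ} (hs : s < P) (ht : t < P)
    (h : E.bwalk d₀ s = E.bwalk d₀ t) : s = t := by
  wlog hst : s ≤ t generalizing s t
  · exact (this ht hs h.symm (le_of_not_ge hst)).symm
  rcases hst.eq_or_lt with rfl | hlt
  · rfl
  · exfalso
    have key : E.bwalk d₀ (0 + s) = E.bwalk d₀ ((t - s) + s) := by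
      rwa [zero_add, Nat.sub_add_cancel hlt.le]
    exact hmin (t - s) (by omega) (by omega) (bwalk_eq_of_add_eq h₀ s key).symm

/-- After a period the walk repeats. [folklore] -/
theorem bwalk_add_period {P : ℕ} (hP : E.bwalk d₀ P = d₀) (n : ℕ) : E.bwalk d₀ (n + P) = E.bwalk d₀ n := by
  induction n with
  | zero => rw [zero_add, hP, bwalk_zero]
  | succ n ih => rw [show n + 1 + P = (n + P) + 1 by omega, bwalk_succ, ih, bwalk_succ]

/-! ### Winding number one on the side-component of the start face -/

variable {P : ℕ} {hPpos : 0 < P} {hcl : (E.bwalk d₀ (0 + P)).1 = (E.bwalk d₀ 0).1}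

/-- Traversal count one for every dart of a minimal period. [folklore] -/
theorem cnt_bloop_eq_one (h₀ : E.IsOutEdge d₀.1 d₀.2) (hmin : ∀ m, 0 < m → m < P → E.bwalk d₀ m ≠ d₀)
    {x : Site 2} {k : Fin 4} (h : ∃ t < P, E.bwalk d₀ t = (x, k)) :
    (bloop 0 P hPpos hcl).cnt (toZ2 x) (toZ2 (x + cornerUnit k)) = 1 := by
  classical
  rw [cnt_bloop]
  obtain ⟨t, ht, htd⟩ := h
  have : ((Finset.range P).filter fun s => E.bwalk d₀ (0 + s) = (x, k)) = {t} := by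
    refine Finset.eq_singleton_iff_unique_mem.2 ⟨?_, fun s hs => ?_⟩
    · exact Finset.mem_filter.2 ⟨Finset.mem_range.2 ht, by rw [zero_add]; exact htd⟩
    · rw [Finset.mem_filter, Finset.mem_range, zero_add] at hs
      exact bwalk_injOn_of_minimal h₀ hmin hs.1 ht (hs.2.trans htd.symm)
  rw [this, Finset.card_singleton]; rfl

/-- **Winding number one on every inner face joined to the start face by side steps through inner
faces** (regular domain): left faces of the walk have winding number one (jump across each dart,
right faces zero), and the walk traverses no side between two inner faces. [folklore] -/
theorem W_bloop_eq_one_of_reach (hδ : 0 < E.δ) (h₀ : E.IsOutEdge d₀.1 d₀.2)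
    (hmin : ∀ m, 0 < m → m < P → E.bwalk d₀ m ≠ d₀)
    (hΩo : IsOpen E.Ω) (hext : IsConnected (closure E.Ω)ᶜ) (hunb : ¬ Bornology.IsBounded (closure E.Ω)ᶜ)
    (hfr : frontier E.Ω ⊆ closure (closure E.Ω)ᶜ) {f : Site 2}
    (hf : ReflTransGen (fun f f' : Site 2 => E.IsInnerFace f ∧ E.IsInnerFace f' ∧
      (f' = f + cornerUnit 0 ∨ f = f' + cornerUnit 0 ∨ f' = f + cornerUnit 1 ∨ f = f' + cornerUnit 1))
      (faceAt d₀.1 d₀.2) f) :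
    (bloop 0 P hPpos hcl).W (toZ2 f) = 1 := by
  set c := bloop 0 P hPpos hcl with hc
  -- the start face
  have hstart : c.W (toZ2 (faceAt d₀.1 d₀.2)) = 1 := by
    have h1 := cnt_bloop_eq_one (hPpos := hPpos) (hcl := hcl) h₀ hmin ⟨0, hPpos, by rw [bwalk_zero]⟩
    have h2 := cnt_bloop_reverse (i := 0) (m := P) (hm := hPpos) (hcl := hcl) h₀ h₀
    have h3 := W_bloop_right_eq_zero (i := 0) (m := P) (hm := hPpos) (hcl := hcl) hδ h₀ hΩo hext hunb hfr 0
    simp only [bwalk_zero] at h3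
    rw [← hc] at h1 h2 h3
    rw [W_faceAt_eq_add_one_of_cnt c h1 h2, h3]; rfl
  -- no jump across a side between two inner faces
  have hside : ∀ (x : Site 2) (k : Fin 4), E.IsInnerFace (faceAt x k) → E.IsInnerFace (faceAt x (k + 3)) →
      c.W (toZ2 (faceAt x k)) = c.W (toZ2 (faceAt x (k + 3))) := by
    intro x k hk hk3
    refine W_faceAt_eq_of_cnt c ?_ ?_
    · exact cnt_bloop_of_forall_ne (hm := hPpos) (hcl := hcl) fun t _ h => by
        have := isOutEdge_bwalk h₀ (0 + t)
        rw [h] at this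
        exact this.2 hk3
    · have := cnt_bloop_of_forall_ne (i := 0) (m := P) (hm := hPpos) (hcl := hcl)
        (x := x + cornerUnit k) (k := k + 2) fun t _ h => by
          have hout := isOutEdge_bwalk h₀ (0 + t)
          rw [h] at hout
          apply hout.2
          have e : ∀ k : Fin 4, k + 2 + 3 = k + 1 := by decide
          rw [e, faceAt_add_unit_succ]
          exact hk
      rwa [add_cornerUnit_add_cornerUnit_add_two] at this
  induction hf with
  | refl => exact hstart
  | @tail f₁ f₂ _ hstep ih =>
    obtain ⟨hf₁, hf₂, hcase⟩ := hstep
    rcases hcase with rfl | rfl | rfl | rfl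
    · -- `f₂ = f₁ + e₀`: the north dart at `f₁ + e₀` has left face `f₁`, right face `f₂`
      have e1 : faceAt (f₁ + cornerUnit 0) 1 = f₁ := by
        rw [show (1 : Fin 4) = 0 + 1 from rfl, faceAt_add_unit_succ]; simp [faceAt, cornerOff]
      have e2 : faceAt (f₁ + cornerUnit 0) (1 + 3) = f₁ + cornerUnit 0 := by
        rw [show (1 : Fin 4) + 3 = 0 from rfl]; simp [faceAt, cornerOff]
      have := hside (f₁ + cornerUnit 0) 1 (e1.symm ▸ hf₁) (e2.symm ▸ hf₂)
      rw [e1, e2] at this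
      rw [← this, ih]
    · have e1 : faceAt (f₂ + cornerUnit 0) 1 = f₂ := by
        rw [show (1 : Fin 4) = 0 + 1 from rfl, faceAt_add_unit_succ]; simp [faceAt, cornerOff]
      have e2 : faceAt (f₂ + cornerUnit 0) (1 + 3) = f₂ + cornerUnit 0 := by
        rw [show (1 : Fin 4) + 3 = 0 from rfl]; simp [faceAt, cornerOff]
      have := hside (f₂ + cornerUnit 0) 1 (e1.symm ▸ hf₂) (e2.symm ▸ hf₁)
      rw [e1, e2] at this
      rw [this, ih]
    · -- `f₂ = f₁ + e₁`: the west dart at `f₁ + e₀ + e₁` has left face `f₁`, right face `f₂`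
      have e1 : faceAt (f₁ + cornerUnit 0 + cornerUnit 1) 2 = f₁ := by
        rw [show (2 : Fin 4) = 1 + 1 from rfl, faceAt_add_unit_succ, show (1 : Fin 4) = 0 + 1 from rfl,
          faceAt_add_unit_succ]; simp [faceAt, cornerOff]
      have e2 : faceAt (f₁ + cornerUnit 0 + cornerUnit 1) (2 + 3) = f₁ + cornerUnit 1 := by
        rw [show (2 : Fin 4) + 3 = 0 + 1 from rfl, add_right_comm, faceAt_add_unit_succ]
        simp [faceAt, cornerOff]
      have := hside (f₁ + cornerUnit 0 + cornerUnit 1) 2 (e1.symm ▸ hf₁) (e2.symm ▸ hf₂)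
      rw [e1, e2] at this
      rw [← this, ih]
    · have e1 : faceAt (f₂ + cornerUnit 0 + cornerUnit 1) 2 = f₂ := by
        rw [show (2 : Fin 4) = 1 + 1 from rfl, faceAt_add_unit_succ, show (1 : Fin 4) = 0 + 1 from rfl,
          faceAt_add_unit_succ]; simp [faceAt, cornerOff]
      have e2 : faceAt (f₂ + cornerUnit 0 + cornerUnit 1) (2 + 3) = f₂ + cornerUnit 1 := by
        rw [show (2 : Fin 4) + 3 = 0 + 1 from rfl, add_right_comm, faceAt_add_unit_succ]
        simp [faceAt, cornerOff]
      have := hside (f₂ + cornerUnit 0 + cornerUnit 1) 2 (e1.symm ▸ hf₂) (e2.symm ▸ hf₁)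
      rw [e1, e2] at this
      rw [this, ih]

/-- **A face-boundary dart whose left face is joined to the start face by side steps through inner
faces lies on the walk** (regular domain): otherwise the walk would traverse its edge in neither
direction, and the winding number (`1` on its left face, `0` on its right face) would not jump.
[folklore] -/
theorem exists_bwalk_eq_of_reach (hδ : 0 < E.δ) (h₀ : E.IsOutEdge d₀.1 d₀.2)
    (hPpos : 0 < P) (hP : E.bwalk d₀ P = d₀) (hmin : ∀ m, 0 < m → m < P → E.bwalk d₀ m ≠ d₀)
    (hΩo : IsOpen E.Ω) (hext : IsConnected (closure E.Ω)ᶜ) (hunb : ¬ Bornology.IsBounded (closure E.Ω)ᶜ)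
    (hfr : frontier E.Ω ⊆ closure (closure E.Ω)ᶜ) {x : Site 2} {k : Fin 4} (hx : E.IsOutEdge x k)
    (hf : ReflTransGen (fun f f' : Site 2 => E.IsInnerFace f ∧ E.IsInnerFace f' ∧
      (f' = f + cornerUnit 0 ∨ f = f' + cornerUnit 0 ∨ f' = f + cornerUnit 1 ∨ f = f' + cornerUnit 1))
      (faceAt d₀.1 d₀.2) (faceAt x k)) :
    ∃ t < P, E.bwalk d₀ t = (x, k) := by
  have hcl : (E.bwalk d₀ (0 + P)).1 = (E.bwalk d₀ 0).1 := by rw [zero_add, hP, bwalk_zero]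
  by_contra hne
  push Not at hne
  set c := bloop 0 P hPpos hcl with hc
  have h1 := W_bloop_eq_one_of_reach (hPpos := hPpos) (hcl := hcl) hδ h₀ hmin hΩo hext hunb hfr hf
  have h0 : c.W (toZ2 (faceAt x (k + 3))) = 0 :=
    W_bloop_eq_zero_of_not_isInnerFace hδ h₀ hΩo hext hunb hfr hx.2 (isCorner_faceAt _ _)
      hx.fst_mem_meshDomain
  have hf0 : c.cnt (toZ2 x) (toZ2 (x + cornerUnit k)) = 0 :=
    cnt_bloop_of_forall_ne (hm := hPpos) (hcl := hcl) fun t ht h => hne t ht (by rw [zero_add] at h; exact h)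
  have hr0 : c.cnt (toZ2 (x + cornerUnit k)) (toZ2 x) = 0 :=
    cnt_bloop_reverse (i := 0) (m := P) (hm := hPpos) (hcl := hcl) h₀ hx
  have := W_faceAt_eq_of_cnt c hf0 hr0
  rw [← hc] at h1
  rw [h1, h0] at this
  exact one_ne_zero this

/-! ### Following the walk: a connection avoiding the two cut edges -/

/-- **Following the boundary walk from the head of a dart of the walk back to the start**, in the
graph of `Ω_δ`-edges between boundary sites with the edges of the start dart `d₀ = (u_a, k_a)` and
of the dart `(u_b, k_b) = bwalk d₀ t` (`0 < t < P`) deleted: the head `u_b + cornerUnit k_b` is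
joined to `u_a` (the darts at times `t + 1, …, P - 1` are face-boundary darts other than the two,
and never their reverses). [folklore] -/
theorem reachable_deleteEdges_of_bwalk (h₀ : E.IsOutEdge d₀.1 d₀.2)
    {P : ℕ} (hP : E.bwalk d₀ P = d₀) (hmin : ∀ m, 0 < m → m < P → E.bwalk d₀ m ≠ d₀)
    {t : ℕ} (ht0 : 0 < t) (htP : t < P)
    (hua : d₀.1 ∈ E.zdBoundary) (hva : d₀.1 + cornerUnit d₀.2 ∈ E.zdBoundary)
    (hub : (E.bwalk d₀ t).1 ∈ E.zdBoundary) (hvb : (E.bwalk d₀ t).1 + cornerUnit (E.bwalk d₀ t).2 ∈ E.zdBoundary) :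
    (((discreteDomainGraph E.Ω E.δ).induce E.zdBoundary).deleteEdges
        {s(⟨d₀.1, hua⟩, ⟨d₀.1 + cornerUnit d₀.2, hva⟩),
         s(⟨(E.bwalk d₀ t).1, hub⟩, ⟨(E.bwalk d₀ t).1 + cornerUnit (E.bwalk d₀ t).2, hvb⟩)}).Reachable
      ⟨(E.bwalk d₀ t).1 + cornerUnit (E.bwalk d₀ t).2, hvb⟩ ⟨d₀.1, hua⟩ := by
  set G := discreteDomainGraph E.Ω E.δ with hG
  set B := E.zdBoundary with hB
  set H' := (G.induce B).deleteEdges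
        {s(⟨d₀.1, hua⟩, ⟨d₀.1 + cornerUnit d₀.2, hva⟩),
         s(⟨(E.bwalk d₀ t).1, hub⟩, ⟨(E.bwalk d₀ t).1 + cornerUnit (E.bwalk d₀ t).2, hvb⟩)} with hH'
  -- every vertex of the walk is a boundary site
  have hmemB : ∀ s, (E.bwalk d₀ s).1 ∈ B := fun s =>
    ((isOutEdge_bwalk h₀ s).isFaceBoundaryEdge).mem_zdBoundary.1
  -- one step along a dart other than the two deleted ones
  have hstep : ∀ s, t < s → s < P →
      H'.Adj ⟨(E.bwalk d₀ s).1, hmemB s⟩ ⟨(E.bwalk d₀ (s + 1)).1, hmemB (s + 1)⟩ := by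
    intro s hts hsP
    have hout := isOutEdge_bwalk h₀ s
    rw [hH', deleteEdges_adj]
    refine ⟨?_, ?_⟩
    · show G.Adj (E.bwalk d₀ s).1 (E.bwalk d₀ (s + 1)).1
      rw [bwalk_fst_succ]
      exact adj_of_isInnerFace_faceAt hout.1 (Or.inl rfl)
    · simp only [Set.mem_insert_iff, Set.mem_singleton_iff, not_or]
      -- the edge of the dart at time `s` is neither `e_a` nor `e_b`
      have key : ∀ (y : Site 2) (j : Fin 4), E.IsOutEdge y j → E.bwalk d₀ s ≠ (y, j) →
          ∀ (hy : y ∈ B) (hy' : y + cornerUnit j ∈ B),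
          s(⟨(E.bwalk d₀ s).1, hmemB s⟩, ⟨(E.bwalk d₀ (s + 1)).1, hmemB (s + 1)⟩) ≠
            s((⟨y, hy⟩ : B), ⟨y + cornerUnit j, hy'⟩) := by
        intro y j hyj hne hy hy' h
        rw [Sym2.eq_iff] at h
        rcases h with ⟨h1, h2⟩ | ⟨h1, h2⟩
        · have h1' : (E.bwalk d₀ s).1 = y := congrArg Subtype.val h1
          have h2' : (E.bwalk d₀ (s + 1)).1 = y + cornerUnit j := congrArg Subtype.val h2
          rw [bwalk_fst_succ, h1'] at h2'
          have hk : (E.bwalk d₀ s).2 = j := cornerUnit_injective (add_left_cancel h2')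
          exact hne (Prod.ext h1' hk)
        · have h1' : (E.bwalk d₀ s).1 = y + cornerUnit j := congrArg Subtype.val h1
          have h2' : (E.bwalk d₀ (s + 1)).1 = y := congrArg Subtype.val h2
          rw [bwalk_fst_succ, h1', add_assoc] at h2'
          have hk : cornerUnit j + cornerUnit (E.bwalk d₀ s).2 = 0 := by
            have := h2'; nth_rewrite 2 [← add_zero y] at this; exact add_left_cancel this
          have hk' : (E.bwalk d₀ s).2 = j + 2 := by
            apply cornerUnit_injective
            rw [cornerUnit_add_two, eq_neg_iff_add_eq_zero, add_comm, hk]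
          exact bwalk_ne_reverse h₀ hyj s (Prod.ext h1' hk')
      refine ⟨key _ _ h₀ ?_ hua hva, key _ _ (isOutEdge_bwalk h₀ t) ?_ hub hvb⟩
      · intro h
        exact hmin s (by omega) hsP h
      · intro h
        exact absurd (bwalk_injOn_of_minimal h₀ hmin hsP htP h) (by omega)
  -- iterate from `t + 1` to `P`
  have hreach : ∀ m, t + 1 + m ≤ P →
      H'.Reachable ⟨(E.bwalk d₀ (t + 1)).1, hmemB (t + 1)⟩ ⟨(E.bwalk d₀ (t + 1 + m)).1, hmemB (t + 1 + m)⟩ := by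
    intro m
    induction m with
    | zero => intro; exact Reachable.refl _
    | succ m ih =>
      intro hm
      exact (ih (by omega)).trans (hstep (t + 1 + m) (by omega) (by omega)).reachable
  have hend := hreach (P - (t + 1)) (by omega)
  have hPeq : t + 1 + (P - (t + 1)) = P := by omega
  have h1 : (⟨(E.bwalk d₀ (t + 1)).1, hmemB (t + 1)⟩ : B) =
      ⟨(E.bwalk d₀ t).1 + cornerUnit (E.bwalk d₀ t).2, hvb⟩ := Subtype.ext (bwalk_fst_succ t)
  have h2 : (⟨(E.bwalk d₀ (t + 1 + (P - (t + 1)))).1, hmemB (t + 1 + (P - (t + 1)))⟩ : B) = ⟨d₀.1, hua⟩ :=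
    Subtype.ext (by simp only [hPeq, hP])
  rw [h1, h2] at hend
  exact hend

end Summit.CriticalPhenomena.CardyFormulaZ2.Theorems.DiscretisationFamilyExists

end
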